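import Literature.NumberTheory.Transcendental.PadicCW77Main
import Literature.NumberTheory.Transcendental.Waldschmidt1980EndgameCW
import HarnessLib

/-!
# The `p`-adic Cijsouw–Waldschmidt descent: the contradiction at the top level (endgame)

Support file (proved theorems only; no named fact), sequel to `PadicCW77Main.lean`
(cell `abc-stewartyu`, WP-A5): the input `PadicCW77.Setup.Endgame` of the composition `main` is
DISCHARGED here — `endgame_holds`. It is the twin, on the sign-free rational cores of
`PadicCW77.Setup`, of the tree's archimedean `CW77.Setup.w80_endgame` (Waldschmidt 1980, §3.5):
at the level `J₀` where the range of the eliminated exponent is empty (`L_θ < 2^{J₀}`) the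
relations `coreSum_{J₀,τ}(s) = 0` (odd `s < 2^{J₀} S₀`, `|τ| < T/2^{J₀}`) force all `p(u) = 0`, by
the Vandermonde argument in the `τⱼ` and the zero count of the `Δ`-polynomials — the abstract
`Waldschmidt1980.endgame`, which needs of the generators only `αⱼ ≠ 0` (no positivity: the
place plays no role here).

## References
* [Waldschmidt1980] M. Waldschmidt, Acta Arith. 37 (1980), §3.5 (p. 274).
* [CijsouwWaldschmidt1977] P. L. Cijsouw, M. Waldschmidt, Compositio Math. 34 (1977), §4 Step 3.
-/

noncomputable section

open Finset Polynomial
open Literature.NumberTheory.Transcendental.Waldschmidt1980 (wPolyQ wPolyQ_ne_zero natDegree_wPolyQ)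

namespace Literature.NumberTheory.Transcendental

namespace PadicCW77

open CW77.Setup (Idx Tau tauNorm)

namespace Setup

variable (S : Setup) {h Lb : ℕ}

/-- **The rational core at the top level, as a double sum over `ρ` and the box `∏ⱼ[0, ⌊Lⱼ/2^{J₀}⌋]`**
(twin of `CW77.Setup.coreSum_top_eq`): `coreSum_{J₀,τ}(s) = τ₀! ∑_ρ ∑_λ p(ρ,λ,0) ·
((1/τ₀!)d^{τ₀}w_ρ)(s) · ∏ⱼ (αⱼ^{sλⱼ} λⱼ^{τⱼ})` (`L_θ < 2^{J₀}`, so `λ_θ = 0`, `γⱼ = λⱼ`,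
`qE = ∏ αⱼ^{λⱼ s}`). [cite: Waldschmidt1980, §3.5 (p. 274)] -/
theorem coreSum_top_eq {L : Fin S.d → ℕ} {Lθ J₀ : ℕ} (hLθ : Lθ < 2 ^ J₀)
    (p : Idx S.d h Lb → ℤ) (τ : Tau S.d) (s : ℕ) :
    S.coreSum J₀ J₀ (S.frame.box (h := h) (Lb := Lb) L Lθ J₀) p τ s =
      (τ.1.factorial : ℚ) * ∑ ρ : Fin h × Fin Lb, ∑ lam : ∀ j : Fin S.d, Fin (L j / 2 ^ J₀ + 1),
        (p (ρ, (fun j => ((lam j : ℕ)), 0)) : ℚ) *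
          (hasseDeriv τ.1 (wPolyQ (ρ.1 : ℕ) (ρ.2 : ℕ) h)).eval (s : ℚ) *
          ∏ j, ((S.α j) ^ (s * (lam j : ℕ)) * (((lam j : ℕ) : ℚ)) ^ (τ.2 j)) := by
  classical
  unfold coreSum CW77.Setup.box
  rw [Nat.div_eq_of_lt hLθ, zero_add, Finset.sum_product, Finset.mul_sum]
  refine Finset.sum_congr rfl fun ρ _ => ?_
  rw [Finset.sum_product, Finset.mul_sum]
  simp only [Finset.sum_range_one]
  -- the sum over `piFinset` as a sum over the dependent box
  symm
  refine Finset.sum_bij' (fun lam _ => fun j => ((lam j : ℕ)))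
    (fun μ hμ => fun j => ⟨μ j, mem_range.mp (Fintype.mem_piFinset.mp hμ j)⟩) ?_ ?_ ?_ ?_ ?_
  · intro lam _; exact Fintype.mem_piFinset.mpr fun j => mem_range.mpr (lam j).isLt
  · intro μ _; exact mem_univ _
  · intro lam _; rfl
  · intro μ _; rfl
  · intro lam _
    unfold qTerm qE CW77.Setup.qA CW77.Setup.γ
    rw [S.frame.qΔ_top_eq]
    simp only [Nat.cast_zero, zero_mul, add_zero, pow_zero, mul_one]
    rw [Finset.prod_mul_distrib]
    have hcomm : ∀ j : Fin S.d, (S.α j) ^ ((lam j : ℕ) * s) = (S.α j) ^ (s * (lam j : ℕ)) := by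
      intro j; rw [mul_comm]
    simp_rw [hcomm]
    ring

/-- **§3.5 — the contradiction at the top of the descent** (twin of `CW77.Setup.w80_endgame`): the
invariant `Inv` at level `J₀` with `L_θ < 2^{J₀}`, `T' + ∑ⱼ ⌊Lⱼ/2^{J₀}⌋ ≤ ⌊T/2^{J₀}⌋` and
`h · Lb < T' · #{odd s < 2^{J₀} S₀}` is contradictory. [cite: Waldschmidt1980, §3.5 (p. 274)] -/
theorem padic_endgame {J₀ : ℕ} {L : Fin S.d → ℕ} {Lθ S₀ T : ℕ} {P : ℤ} {p : Idx S.d h Lb → ℤ}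
    (inv : S.Inv J₀ L Lθ S₀ T P J₀ p) (hLθ : Lθ < 2 ^ J₀) {T' : ℕ}
    (hcount : h * Lb < T' * ((range (2 ^ J₀ * S₀)).filter Odd).card)
    (hT' : T' + ∑ j, L j / 2 ^ J₀ ≤ T / 2 ^ J₀) : False := by
  classical
  set L' : Fin S.d → ℕ := fun j => L j / 2 ^ J₀ with hL'
  set boxJ := S.frame.box (h := h) (Lb := Lb) L Lθ J₀ with hboxJ
  set pts : Finset ℕ := (range (2 ^ J₀ * S₀)).filter Odd with hpts
  set p' : (Fin h × Fin Lb) → (∀ j : Fin S.d, Fin (L' j + 1)) → ℚ :=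
    fun ρ lam => (p (ρ, (fun j => ((lam j : ℕ)), 0)) : ℚ) with hp'
  -- the vanishing in the form of `Waldschmidt1980.endgame`
  have hvan : ∀ s ∈ pts, ∀ k < T', ∀ τb : ∀ j : Fin S.d, Fin (L' j + 1),
      ∑ ρ : Fin h × Fin Lb, ∑ lam : ∀ j : Fin S.d, Fin (L' j + 1),
        p' ρ lam * (hasseDeriv k (wPolyQ (ρ.1 : ℕ) (ρ.2 : ℕ) h)).eval ((fun n : ℕ => (n : ℚ)) s) *
          ∏ j, ((S.α j) ^ (s * (lam j : ℕ)) * (((lam j : ℕ) : ℚ)) ^ ((τb j : ℕ))) = 0 := by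
    intro s hs k hk τb
    rw [hpts, mem_filter, mem_range] at hs
    set τ : Tau S.d := (k, fun j => (τb j : ℕ)) with hτ
    have hτn : tauNorm τ < T / 2 ^ J₀ := by
      show k + ∑ j, (τb j : ℕ) < T / 2 ^ J₀
      have hle : ∑ j, (τb j : ℕ) ≤ ∑ j, L' j :=
        Finset.sum_le_sum fun j _ => Nat.lt_succ_iff.mp (τb j).isLt
      have hT'' : T' + ∑ j, L' j ≤ T / 2 ^ J₀ := hT'
      omega
    have hrel := inv.rel s hs.1 hs.2 τ hτn
    rw [S.coreSum_top_eq hLθ p τ s] at hrel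
    have hk0 : (k.factorial : ℚ) ≠ 0 := by exact_mod_cast (Nat.factorial_pos k).ne'
    have h0 := (mul_eq_zero.mp hrel).resolve_left hk0
    simpa [hp', hτ] using h0
  have hend := Waldschmidt1980.endgame (K := ℚ) (fun ρ : Fin h × Fin Lb => wPolyQ (ρ.1 : ℕ) (ρ.2 : ℕ) h)
    (fun ρ => wPolyQ_ne_zero _ _ _) (CW77.Setup.injective_natDegree_wPolyQ h Lb) (N := h * Lb)
    (fun ρ => by
      rw [natDegree_wPolyQ]
      have h1 := ρ.1.isLt; have h2 := ρ.2.isLt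
      have h3 : ((ρ.2 : ℕ) + 1) * h = (ρ.2 : ℕ) * h + h := by ring
      have h4 : ((ρ.2 : ℕ) + 1) * h ≤ Lb * h := Nat.mul_le_mul_right h h2
      rw [mul_comm h Lb]; omega)
    L' (fun j => S.α j) (fun j => S.α_ne j) pts (fun n : ℕ => (n : ℚ))
    (fun a _ b _ hab => Nat.cast_injective (R := ℚ) hab) T' hcount p' hvan
  -- all `p(u)` vanish
  apply (inv.nonzero).elim
  intro u hu
  by_cases hmem : u ∈ boxJ
  · rw [hboxJ, S.frame.mem_box_top_iff hLθ] at hmem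
    obtain ⟨hμ, hθ⟩ := hmem
    have hlam : p' u.1 (fun j => ⟨u.2.1 j, Nat.lt_succ_of_le (hμ j)⟩) = 0 := by
      rw [hend]; rfl
    simp only [hp'] at hlam
    have hu_eq : u = (u.1, (fun j => u.2.1 j, 0)) := by
      rcases u with ⟨ρ, μ, lθ⟩
      simp only at hθ ⊢
      rw [hθ]
    rw [hu_eq] at hu
    exact hu (by exact_mod_cast hlam)
  · exact hmem (inv.supp u hu)

/-- **The input `Endgame` of `PadicCW77.Setup.main` holds** whenever `L_θ < 2^{J₀}` and the budget /
count inequalities of §3.5 are satisfied (WP-A4 supplies them for its parameters).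
[cite: Waldschmidt1980, §3.5 (p. 274)] -/
theorem endgame_holds {J₀ : ℕ} {L : Fin S.d → ℕ} {Lθ S₀ T : ℕ} {P : ℤ} (hLθ : Lθ < 2 ^ J₀) {T' : ℕ}
    (hT' : T' + ∑ j, L j / 2 ^ J₀ ≤ T / 2 ^ J₀)
    (hcount : h * Lb < T' * ((range (2 ^ J₀ * S₀)).filter Odd).card) :
    S.Endgame (h := h) (Lb := Lb) J₀ L Lθ S₀ T P :=
  fun _ inv => S.padic_endgame inv hLθ hcount hT'

end Setup

end PadicCW77

end Literature.NumberTheory.Transcendental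

end
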